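import Literature.AnabelianGeometry.EtaleTheta.Discharge.Sec5DictionaryJointWitness

/-!
# [EtTh] §5 / §2: CLOSED toy data no. 9 — a §5 datum with `s^⊔_N ≠ s^⊓_N` whose bi-Kummer difference is a genuine
# Kummer cocycle, over a §2 datum with a NON-TRIVIAL theta class (witness material for Lemma 5.9 (iv), pp. 330–332 / PDF pp. 104–106)

Mochizuki, *The étale theta function and its Frobenioid-theoretic manifestations*, Publ. RIMS **45** (2009), §5
[cite: MochizukiEtTh2009, §5 p.330–332 (PDF pp.104–106); Prop 5.2 (iii) p.324 (PDF p.98); Prop 4.3 (iii) p.317 (PDF p.91)].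
abc-iut cell, block F (fact-proving wave), seat abc-iut-f-116 (gen 3), tranche 116 of `plan/F-TRANCHES.tsv` (rows F-0521
`ThetaSectionCompat`, F-1306 `CyclotomicCharacterCompatX`, F-0520 `KummerOutReached` of abc-iut-L2-t11's
`Discharge/Sec5EnvelopeTopology.lean`).  WITNESS DATA (definitions + computation lemmas) over abc-iut-f-120's toy
infrastructure (`FrobenioidThetaToyData.lean`: `Toy.Pi`, `Toy.stub`, `Toy.autEquiv`, `Toy.homOf`; `Toy.invAction` of
`FrobenioidMonoThetaSchemaNegative.lean`); nothing landed is edited, no `Prop` fact, no instance, no notation.  Consumed by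
the proof-only companions `Discharge/Sec5ToyNineFacts.lean` (`Facts`, the dictionary rows) and
`Discharge/Sec5DictionaryThetaClassWitness.lean` (Lemma 5.9 (iv) end-to-end with a non-trivial theta class).

WHY.  Every closed §5 datum in the tree so far (abc-iut-f-115's `Sec5Toy.datum`, abc-iut-f-120's `toy₁…toy₄`, this seat's
gen-0 toy) is built with `Toy.frd`, where `s^⊔_N := s^⊓_N := id` and `s^⊔-gp_N := s^⊓-gp_N|_{H_{B_N}}`: the bi-Kummer difference
cocycle of Prop. 4.3 (iii) is TRIVIAL, so F-0521 `ThetaSectionCompat` (Prop. 5.2 (iii): the difference cocycle IS the mod `N`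
étale theta class) was witnessed only for `η := 1` (p436178, toy no. 3, where `ρ` kills `Π^tp_Ÿ̲`; second-read note of
abc-iut-w5-d070).  Toy no. 9 makes it non-trivial:
* `Aut_D(B_N^bs) := H₉ := ℤ/3 × ℤˣ` acts on `O^×(B_N) := ℤ/9` by the Kummer character `kumChar (k, ε) = 4^k·ε`;
  `Aut_C(B_N) := G₉ := ℤ/9 ⋊ H₉`, `O^×(B_N^birat) := ℤ/9 × ℚˣ`, constants `ℚˣ` (so `(O_K^×)^{1/3} = μ_3(B_N) = 3ℤ/9`), `N := 3`;
* **`s^⊓_N := id`, `s^⊔_N := w := 1 ∈ ℤ/9`** (base-equivalent, DISTINCT); `SgpCupSpec` (p.331) then FORCES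
  `s^⊔-gp_N = w·s^⊓-gp_N·w⁻¹`, so the difference is the Kummer cocycle `h ↦ w·(h·w)⁻¹ = 1 − kumChar(h)` of `w` (a cartoon of
  "`w = Θ̈^{1/N}`"), `μ_3`-valued on `H_{B_N}` and NON-TRIVIAL; `ρ₀(a, b, τ) := (b mod 3, sign τ)` is non-trivial on `Π^tp_Ÿ̲`;
* **`env₉ : ThetaEnvData 3`** over the same `Π`: `G_K := ℤˣ` via `sign ∘ s3`, `μ₃ := ℤ/3` with the inversion character, and
  `η̈^Θ mod 3 := {η₉}`, `η₉(0, b, τ) := b mod 3` — a NON-TRIVIAL CLASS (coboundaries vanish on `Π^tp_Ÿ`);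
* **`toy₉`** (Π-block = `env₉`'s, as in abc-iut-L2-t4's `ofThetaEnvData`, written as a structure literal so that every field
  computes) and the identification of cyclotomes **`muEquiv₉ : μ_3(B_N) ⥲ μ₃`** (`inl(3k) ↦ k`).
HONEST FRAMING: toy data exhibiting the CONSISTENCY of the typed §5/§2 interfaces with a non-trivial theta class; they say
nothing about the genuine Tate-curve data of [EtTh] (a refereed paper), nothing about [IUTchIII] Cor. 3.12, and take no
side; typed ≠ proved.
-/

namespace Literature.AnabelianGeometry.EtaleTheta

open CategoryTheory
open Literature.AlgebraicGeometry.Frobenioids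

namespace ThetaFrobenioid

namespace Toy

/-! ### The groups: `Aut_D(B_N^bs) := H₉ = ℤ/3 × ℤˣ` acting on `O^×(B_N) := ℤ/9` by `(k, ε) ↦ ×4^k·ε` -/

/-- `H₉ := ℤ/3 × ℤˣ` (think `Gal(K(μ₉, ϖ^{1/3})/K)`-cartoon: a Kummer part `ℤ/3` and a cyclotomic part `ℤˣ`). [folklore] -/
abbrev H₉ : Type := Multiplicative (ZMod 3) × ℤˣ

/-- The Kummer character `H₉ → ℤ/9`, `(k, ε) ↦ 4^k · ε` (so `ℤ/3 ∋ k` acts unipotently: trivially on `3ℤ/9` and on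
`(ℤ/9)/(3ℤ/9)`, while `ε` acts by `±1`). [folklore] -/
def kumChar (h : H₉) : ZMod 9 := (4 : ZMod 9) ^ (Multiplicative.toAdd h.1).val * ((h.2 : ℤ) : ZMod 9)

/-- `kumChar 1 = 1`. [folklore] -/
private theorem kumChar_one : kumChar 1 = 1 := by decide

/-- `kumChar` is multiplicative. [folklore] -/
private theorem kumChar_mul (h h' : H₉) : kumChar (h * h') = kumChar h * kumChar h' := by revert h h'; decide

/-- The action of `H₉` on `ℤ/9` (written multiplicatively) through the Kummer character. [folklore] -/
def kumAction : H₉ →* MulAut (Multiplicative (ZMod 9)) where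
  toFun h :=
    { toFun := fun x => Multiplicative.ofAdd (kumChar h * Multiplicative.toAdd x)
      invFun := fun x => Multiplicative.ofAdd (kumChar h⁻¹ * Multiplicative.toAdd x)
      left_inv := fun x => by
        change Multiplicative.ofAdd (kumChar h⁻¹ * (kumChar h * Multiplicative.toAdd x)) = x
        rw [← mul_assoc, ← kumChar_mul, inv_mul_cancel, kumChar_one, one_mul]; rfl
      right_inv := fun x => by
        change Multiplicative.ofAdd (kumChar h * (kumChar h⁻¹ * Multiplicative.toAdd x)) = x
        rw [← mul_assoc, ← kumChar_mul, mul_inv_cancel, kumChar_one, one_mul]; rfl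
      map_mul' := fun x y => by
        change Multiplicative.ofAdd (kumChar h * (Multiplicative.toAdd x + Multiplicative.toAdd y)) = _
        rw [mul_add]; rfl }
  map_one' := by
    ext x; change Multiplicative.ofAdd (kumChar 1 * Multiplicative.toAdd x) = x; rw [kumChar_one, one_mul]; rfl
  map_mul' h h' := by
    ext x
    change Multiplicative.ofAdd (kumChar (h * h') * Multiplicative.toAdd x) =
      Multiplicative.ofAdd (kumChar h * (kumChar h' * Multiplicative.toAdd x))
    rw [kumChar_mul, mul_assoc]

/-- `kumAction` on elements (the toy Galois action on `O^×(B_N) = ℤ/9`). [cite: MochizukiEtTh2009, Lem 5.8 proof p.331 (PDF p.105)] -/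
theorem kumAction_apply (h : H₉) (x : Multiplicative (ZMod 9)) :
    kumAction h x = Multiplicative.ofAdd (kumChar h * Multiplicative.toAdd x) := rfl

/-- `G₉ := ℤ/9 ⋊ H₉`, the toy `Aut_C(B_N)` (a cartoon of `Gal` of a Kummer tower acting on `9`-th roots). [folklore] -/
abbrev G₉ : Type := Multiplicative (ZMod 9) ⋊[kumAction] H₉

/-- The toy base projection `Aut_C(B_N) ↠ Aut_D(B_N^bs)`. [folklore] -/
abbrev π₉ : G₉ →* H₉ := SemidirectProduct.rightHom

/-- `Ker(G₉ ↠ H₉) = ℤ/9` is abelian. [folklore] -/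
private theorem comm_of_π₉ (a b : G₉) (ha : π₉ a = 1) (hb : π₉ b = 1) : a * b = b * a := by
  change a.right = 1 at ha; change b.right = 1 at hb
  refine SemidirectProduct.ext ?_ (by rw [SemidirectProduct.mul_right, SemidirectProduct.mul_right, mul_comm])
  rw [SemidirectProduct.mul_left, SemidirectProduct.mul_left, ha, hb, map_one, MulAut.one_apply,
    MulAut.one_apply, mul_comm]

/-- `O^×(S) → ℤ/9`, `u ↦ u.left` (a homomorphism on the `Ker π₉`-automorphisms). [folklore] -/
def leftHom₉ (S : SingleObj G₉) : (pre π₉).unitsSubgroup S →* Multiplicative (ZMod 9) where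
  toFun u := (homOf G₉ S u).left
  map_one' := rfl
  map_mul' a b := by
    have ha : (homOf G₉ S a).right = 1 := (mem_unitsSubgroup_pre_iff π₉ S _).mp a.2
    change (homOf G₉ S (a.1 * b.1)).left = (homOf G₉ S a).left * (homOf G₉ S b).left
    rw [map_mul, SemidirectProduct.mul_left, ha, map_one, MulAut.one_apply]

/-- A unit is `inl` of its `ℤ/9`-component. [folklore] -/
private theorem homOf_eq_inl_leftHom₉ (S : SingleObj G₉) (u : (pre π₉).unitsSubgroup S) :
    homOf G₉ S u = SemidirectProduct.inl (leftHom₉ S u) := by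
  have hu : (homOf G₉ S u).right = 1 := (mem_unitsSubgroup_pre_iff π₉ S _).mp u.2
  rw [← SemidirectProduct.inl_left_mul_inr_right (homOf G₉ S u), hu, map_one, mul_one]
  rfl

/-- `u ↦ u.left` is injective on `O^×(S)`. [folklore] -/
private theorem leftHom₉_injective (S : SingleObj G₉) : Function.Injective (leftHom₉ S) := fun a b h =>
  Subtype.ext (homOf_injective G₉ S (by rw [homOf_eq_inl_leftHom₉, homOf_eq_inl_leftHom₉, h]))

/-- The toy birational units `O^×(B_N^birat) := ℤ/9 × ℚˣ`, the constants being the second factor. [folklore] -/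
abbrev B₉ : Type := Multiplicative (ZMod 9) × ℚˣ

/-- "`O^×(B_N) ↪ O^×(B_N^birat)`": `u ↦ (u.left, 1)`. [folklore] -/
def unitsBirat₉ (S : SingleObj G₉) : (pre π₉).unitsSubgroup S →* B₉ := (MonoidHom.inl _ _).comp (leftHom₉ S)

/-- `u ↦ (u.left, 1)` is injective. [folklore] -/
private theorem unitsBirat₉_injective (S : SingleObj G₉) : Function.Injective (unitsBirat₉ S) :=
  fun _ _ h => leftHom₉_injective S (Prod.ext_iff.mp h).1

/-! ### The Π-side: `ρ₀ : Π = ℤ × ℤ × 𝔖₃ ↠ H₉`, `(a, b, τ) ↦ (b mod 3, sign τ)` and the theta cocycle `b mod 3` -/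

/-- `ℤ ↠ ℤ/3`. [folklore] -/
def cast3 : Multiplicative ℤ →* Multiplicative (ZMod 3) := (Int.castAddHom (ZMod 3)).toMultiplicative

/-- `ρ₀ : Π ↠ H₉`, `(a, b, τ) ↦ (b mod 3, sign τ)`. [folklore] -/
def rho₉ : Pi →* H₉ := (cast3.comp zq').prod (Equiv.Perm.sign.comp s3)

/-- `ρ₀` is onto. [folklore] -/
private theorem rho₉_surjective : Function.Surjective rho₉ := by
  rintro ⟨k, ε⟩
  obtain ⟨b, hb⟩ := ZMod.intCast_surjective (Multiplicative.toAdd k)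
  obtain ⟨τ, hτ⟩ := Equiv.Perm.sign_surjective (α := Fin 3) ε
  exact ⟨(1, (Multiplicative.ofAdd b, τ)), Prod.ext (by change Multiplicative.ofAdd ((b : ZMod 3)) = k; rw [hb]; rfl) hτ⟩

/-- `sign ∘ s3 : Π ↠ ℤˣ` is onto. [folklore] -/
private theorem sign_s3_surjective' : Function.Surjective ((Equiv.Perm.sign).comp s3) := by
  intro u
  obtain ⟨τ, hτ⟩ := Equiv.Perm.sign_surjective (α := Fin 3) u
  exact ⟨(1, (1, τ)), hτ⟩

/-- `[Ker(Π ↠ ℤ) : Π^tp_Ÿ̲] = 2`. [folklore] -/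
private theorem piYdd_relIndex' : piYdd.relIndex zq.ker = 2 := by
  have h : (zq.ker).map s3 = ⊤ := top_unique fun σ _ => ⟨(1, (1, σ)), MonoidHom.mem_ker.mpr rfl, rfl⟩
  rw [Subgroup.inf_relIndex_right, Subgroup.relIndex_comap, h, Subgroup.relIndex_top_right]
  exact alternatingGroup.index_eq_two

/-- The toy theta cocycle `η₉ : Π^tp_Ÿ → μ₃`, `(0, b, τ) ↦ b mod 3` (a HOMOMORPHISM, non-trivial). [folklore] -/
def eta₉Hom : piYdd →* Multiplicative (ZMod 3) := cast3.comp (zq'.comp piYdd.subtype)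

/-- On `Π^tp_Ÿ̲` the permutation coordinate is even (`G_K` acts trivially there). [cite: MochizukiEtTh2009, §5 p.332 (PDF p.106)] -/
theorem sign_s3_piYdd (g : piYdd) : Equiv.Perm.sign (s3 (g : Pi)) = 1 :=
  Equiv.Perm.mem_alternatingGroup.mp g.2.1

/-! ### The toy §2 datum `env₉` -/

/-- **Toy §2 data no. 9** (`ThetaEnvData 3`): `Π^tp_X := ℤ × ℤ × 𝔖₃`, `Π^tp_Y := Ker` of the first coordinate,
`Π^tp_Ÿ := Π^tp_Y ∩ s3⁻¹(𝔄₃)`, `G_K := ℤˣ` via `sign ∘ s3`, cyclotome `μ₃ := ℤ/3` with the inversion character, and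
`η̈^Θ mod 3 := {η₉}`, `η₉(0, b, τ) = b mod 3` — a NON-TRIVIAL class (coboundaries vanish on `Π^tp_Ÿ`, where the character
is trivial).  [folklore] -/
noncomputable abbrev env₉ : ThetaEnvData.{0} 3 where
  PiX := Pi
  topPiX := ⊥
  tgPiX := by
    letI : TopologicalSpace Pi := ⊥
    haveI : DiscreteTopology Pi := ⟨rfl⟩
    infer_instance
  G := ℤˣ
  aug := (Equiv.Perm.sign).comp s3
  aug_surjective := sign_s3_surjective'
  PiY := zq.ker
  PiY_normal := inferInstance
  PiY_open := by
    letI : TopologicalSpace Pi := ⊥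
    haveI : DiscreteTopology Pi := ⟨rfl⟩
    exact isOpen_discrete _
  galYX := QuotientGroup.quotientKerEquivOfSurjective zq fun z => ⟨(z, 1), rfl⟩
  PiYdd := piYdd
  PiYdd_le := inf_le_right
  PiYdd_normal := inferInstance
  PiYdd_open := by
    letI : TopologicalSpace Pi := ⊥
    haveI : DiscreteTopology Pi := ⟨rfl⟩
    exact isOpen_discrete _
  index_PiYdd := piYdd_relIndex'
  mu := Multiplicative (ZMod 3)
  topMu := ⊥
  discMu := @DiscreteTopology.mk (Multiplicative (ZMod 3)) ⊥ rfl
  mu_cyclic := inferInstance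
  card_mu := by simp [ZMod.card]
  chi := invAction (Multiplicative (ZMod 3))
  chi_ker_open := by
    letI : TopologicalSpace Pi := ⊥
    haveI : DiscreteTopology Pi := ⟨rfl⟩
    exact isOpen_discrete _
  thetaCocycles := {⇑eta₉Hom}
  thetaCocycles_nonempty := Set.singleton_nonempty _
  isCocycle := by
    intro η hη g h
    rw [Set.mem_singleton_iff] at hη
    subst hη
    change eta₉Hom (g * h) = eta₉Hom g * (invAction _ (Equiv.Perm.sign (s3 (g : Pi)))) (eta₉Hom h)
    rw [sign_s3_piYdd g, map_one, MulAut.one_apply, map_mul]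
  locallyConstant := by
    letI : TopologicalSpace Pi := ⊥
    haveI : DiscreteTopology Pi := ⟨rfl⟩
    intro η _
    exact IsLocallyConstant.of_discrete η
  mul_coboundary_mem := by
    intro η hη c
    rw [Set.mem_singleton_iff] at hη ⊢
    subst hη
    funext g
    simp only [Pi.mul_apply]
    change eta₉Hom g * (c * (invAction _ (Equiv.Perm.sign (s3 (g : Pi))) c)⁻¹) = eta₉Hom g
    rw [sign_s3_piYdd g, map_one, MulAut.one_apply, mul_inv_cancel, mul_one]

/-! ### The toy §5 datum `toy₉` over `env₉`, with `s^⊔_N ≠ s^⊓_N` -/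

/-- The unit `w := 1 ∈ ℤ/9 = O^×(B_N)` serving as `s^⊔_N` (a "`3`-rd root of the theta function": its Kummer
cocycle is the bi-Kummer difference). [folklore] -/
def wElt : G₉ := SemidirectProduct.inl (Multiplicative.ofAdd 1)

/-- `w^bs = 1`: `s^⊔_N = w` is base-equivalent to `s^⊓_N = id`. [cite: MochizukiEtTh2009, §5 p.330 (PDF p.104)] -/
@[simp] theorem π₉_wElt : π₉ wElt = 1 := SemidirectProduct.rightHom_inl _

/-- The section `s^trv_N = s^⊓-gp_N := inr` (through `H₉ ⥲ Aut ⋆`, `G₉ ⥲ Aut ⋆`). [folklore] -/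
def sgp₉ : Aut (SingleObj.star H₉) →* Aut (SingleObj.star G₉) :=
  (autEquiv G₉).toMonoidHom.comp (SemidirectProduct.inr.comp (autEquiv H₉).symm.toMonoidHom)

/-- `ρ := (H₉ ⥲ Aut ⋆) ∘ ρ₀`. [folklore] -/
def rhoAut₉ : Pi →* Aut (SingleObj.star H₉) := (autEquiv H₉).toMonoidHom.comp rho₉

/-- `ρ` is onto. [folklore] -/
private theorem rhoAut₉_surjective : Function.Surjective rhoAut₉ :=
  (autEquiv H₉).surjective.comp rho₉_surjective

/-- `s^⊔-gp_N := w · s^⊓-gp_N · w⁻¹` on `ρ(Π^tp_Ÿ̲)` (the shape FORCED by the defining relation `SgpCupSpec` once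
`s^⊔_N = w ∘ s^⊓_N`). [folklore] -/
def sgpCup₉ : (piYdd.map rhoAut₉) →* Aut (SingleObj.star G₉) :=
  ((MulAut.conj (autEquiv G₉ wElt)).toMonoidHom.comp sgp₉).comp (Subgroup.subtype _)

/-- **Toy §5 data no. 9** (the Π-block IS `env₉`'s, as in abc-iut-L2-t4's `ofThetaEnvData`; spelled out as a
structure literal so that every field computes): `C := BG₉`, `D := BH₉`, `A_⊚ = A_N = B_N = ⋆`, `s^⊓_N := id`,
`s^⊔_N := w` (a unit, so base-equivalent to `id`), `ρ₀ = (b mod 3, sign τ)`, `s^trv_N = s^⊓-gp_N := inr`,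
`s^⊔-gp_N := w·inr·w⁻¹`, `O^×(B_N^birat) := ℤ/9 × ℚˣ`, constants `ℚˣ ↪` second factor, `Θ̈ := 1`, `l := 1`, `N := 3`.
[folklore] -/
abbrev toy₉ : ThetaFrobenioid.{0} (SingleObj G₉) (SingleObj H₉) where
  toTemperedFrobenioidStub := stub π₉ comm_of_π₉ B₉ unitsBirat₉ unitsBirat₉_injective
  lDelta := fun _ => PUnit
  lDeltaMap := fun _ => 1
  l := 1
  odd_l := odd_one
  N := 3
  Acirc := SingleObj.star G₉
  AN := SingleObj.star G₉
  BN := SingleObj.star G₉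
  sCap := 𝟙 _
  sCup := wElt
  base_map_sCap := (map_one π₉).trans (π₉_wElt).symm
  isPreStep_sCap := ⟨rfl, show IsIso ((pre π₉).base.map (𝟙 _)) from inferInstance⟩
  isPreStep_sCup := ⟨rfl, IsIso.of_groupoid _⟩
  PiX := Pi
  instTopPiX := ⊥
  instTopGroupPiX := by
    letI : TopologicalSpace Pi := ⊥
    haveI : DiscreteTopology Pi := ⟨rfl⟩
    infer_instance
  zquot := zq
  zquot_surjective := fun z => ⟨(z, 1), rfl⟩
  PiYdd := piYdd
  PiYdd_le := inf_le_right
  relindex_PiYdd := piYdd_relIndex'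
  PiYdd_normal := inferInstance
  isOpen_PiYdd := by
    letI : TopologicalSpace Pi := ⊥
    haveI : DiscreteTopology Pi := ⟨rfl⟩
    exact isOpen_discrete _
  ρ := rhoAut₉
  ρ_surjective := rhoAut₉_surjective
  isOpen_ker_ρ := by
    letI : TopologicalSpace Pi := ⊥
    haveI : DiscreteTopology Pi := ⟨rfl⟩
    exact isOpen_discrete _
  strv := sgp₉
  sgpCap := sgp₉
  sgpCup := sgpCup₉
  K := ℚ
  constEmb := MonoidHom.inr _ _
  constEmb_injective := fun _ _ h => (Prod.ext_iff.mp h).2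
  thetaFn := 1

/-! ### Units and the cyclotome `μ_3(B_N) = 3ℤ/9` of `toy₉` -/

/-- `O^×(B_N)` of toy no. 9: the automorphisms over `Ker(H₉)`. [cite: MochizukiEtTh2009, §5 p.331 (PDF p.105)] -/
theorem mem_units_toy₉_iff (u : Aut toy₉.BN) : u ∈ toy₉.units toy₉.BN ↔ (homOf G₉ _ u).right = 1 :=
  mem_unitsSubgroup_pre_iff π₉ _ u

/-- The `ℤ/9`-component of a unit, read through "the natural inclusion `O^×(B_N) ↪ O^×(B_N^birat)`" (the §5 stub
field `unitsToBirat`). [cite: MochizukiEtTh2009, Lem 5.8 p.331 (PDF p.105)] -/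
abbrev ub₉ (u : toy₉.units toy₉.BN) : Multiplicative (ZMod 9) := (toy₉.unitsToBirat toy₉.BN u).1

/-- A unit of toy no. 9 is `inl` of its `ℤ/9`-component. [cite: MochizukiEtTh2009, §5 p.331 (PDF p.105)] -/
theorem homOf_unit_toy₉ (u : toy₉.units toy₉.BN) :
    homOf G₉ _ (u : Aut toy₉.BN) = SemidirectProduct.inl (ub₉ u) :=
  homOf_eq_inl_leftHom₉ _ u

/-- `autEquiv (inl n)` is a unit. [cite: MochizukiEtTh2009, §5 p.331 (PDF p.105)] -/
theorem autEquiv_inl_mem_units_toy₉ (n : Multiplicative (ZMod 9)) :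
    autEquiv G₉ (SemidirectProduct.inl n) ∈ toy₉.units toy₉.BN :=
  (mem_units_toy₉_iff _).mpr (by rw [homOf_autEquiv, SemidirectProduct.right_inl])

/-- `(ofAdd x)^3 = 1` in `O^×(B_N) = ℤ/9` iff `3x = 0` (Def. 5.4, for the toy). [cite: MochizukiEtTh2009, Def 5.4 p.327 (PDF p.101)] -/
theorem ofAdd_pow_three_eq_one_iff (x : ZMod 9) : Multiplicative.ofAdd x ^ (3 : ℕ) = 1 ↔ 3 * x = 0 := by
  rw [← ofAdd_nsmul, nsmul_eq_mul, Nat.cast_ofNat]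
  exact ⟨fun h => Multiplicative.ofAdd.injective h, fun h => by rw [h]; rfl⟩

/-- `n^3 = 1` in `O^×(B_N) = ℤ/9` iff `3·n = 0` (Def. 5.4, for the toy). [cite: MochizukiEtTh2009, Def 5.4 p.327 (PDF p.101)] -/
theorem pow_three_eq_one_iff (n : Multiplicative (ZMod 9)) : n ^ (3 : ℕ) = 1 ↔ 3 * Multiplicative.toAdd n = 0 :=
  ofAdd_pow_three_eq_one_iff (Multiplicative.toAdd n)

/-- `μ_3(B_N)` of toy no. 9 `= 3ℤ/9`: `autEquiv (inl n) ∈ μ_3(B_N) ↔ n³ = 1`.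
[cite: MochizukiEtTh2009, Def 5.4 p.327 (PDF p.101)] -/
theorem autEquiv_inl_mem_muTorsion_iff (n : Multiplicative (ZMod 9)) :
    autEquiv G₉ (SemidirectProduct.inl n) ∈ toy₉.muTorsion toy₉.BN toy₉.N ↔ n ^ (3 : ℕ) = 1 := by
  rw [mem_muTorsion]
  refine ⟨fun h => ?_, fun h => ⟨autEquiv_inl_mem_units_toy₉ n, ?_⟩⟩
  · have h2 := congrArg (homOf G₉ _) h.2
    rw [map_pow, homOf_autEquiv, ← map_pow, map_one] at h2
    exact SemidirectProduct.inl_injective (h2.trans (map_one _).symm)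
  · change autEquiv G₉ (SemidirectProduct.inl n) ^ (3 : ℕ) = 1
    rw [← map_pow, ← map_pow, h, map_one, map_one]

/-- A unit `u` lies in `μ_3(B_N)` iff its `ℤ/9`-component is `3`-torsion. [cite: MochizukiEtTh2009, Def 5.4 p.327 (PDF p.101)] -/
theorem unit_mem_muTorsion_iff (u : toy₉.units toy₉.BN) :
    (u : Aut toy₉.BN) ∈ toy₉.muTorsion toy₉.BN toy₉.N ↔ ub₉ u ^ (3 : ℕ) = 1 := by
  have hu : (u : Aut toy₉.BN) = autEquiv G₉ (SemidirectProduct.inl (ub₉ u)) := by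
    apply homOf_injective G₉; rw [homOf_autEquiv, homOf_unit_toy₉]
  rw [hu]; exact autEquiv_inl_mem_muTorsion_iff _

/-! ### The identification of cyclotomes `m : μ_3(B_N) ⥲ μ₃` -/

/-- `ℤ/3 ↪ ℤ/9`, `k ↦ 3k` (onto `3ℤ/9 = μ_3(B_N)`). [folklore] -/
def triple : Multiplicative (ZMod 3) →* Multiplicative (ZMod 9) where
  toFun k := Multiplicative.ofAdd ((3 : ZMod 9) * ((Multiplicative.toAdd k).val : ZMod 9))
  map_one' := by decide
  map_mul' a b := by revert a b; decide

/-- `triple k` is `3`-torsion. [folklore] -/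
private theorem triple_pow_three (k : Multiplicative (ZMod 3)) : triple k ^ (3 : ℕ) = 1 := by revert k; decide

/-- `triple` is injective. [folklore] -/
private theorem triple_injective : Function.Injective triple := by
  intro a b; revert a b; decide

/-- `3ℤ/9 = triple(ℤ/3)`. [folklore] -/
private theorem exists_triple_of_pow_three (n : Multiplicative (ZMod 9)) (h : n ^ (3 : ℕ) = 1) : ∃ k, triple k = n := by
  revert n; decide

/-- `μ₃ → μ_3(B_N)`, `k ↦ inl(3k)`. [cite: MochizukiEtTh2009, Def 5.4 p.327 (PDF p.101)] -/
def muHom₉ : Multiplicative (ZMod 3) →* toy₉.muTorsion toy₉.BN toy₉.N where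
  toFun k := ⟨autEquiv G₉ (SemidirectProduct.inl (triple k)),
    (autEquiv_inl_mem_muTorsion_iff _).mpr (triple_pow_three k)⟩
  map_one' := Subtype.ext (by simp only [map_one]; rfl)
  map_mul' a b := Subtype.ext (by simp only [map_mul]; rfl)

/-- `μ₃ → μ_3(B_N)` is bijective (`μ_3(B_N) = 3ℤ/9`). [cite: MochizukiEtTh2009, Def 5.4 p.327 (PDF p.101)] -/
theorem muHom₉_bijective : Function.Bijective muHom₉ := by
  refine ⟨fun a b h => triple_injective (SemidirectProduct.inl_injective
    ((autEquiv G₉).injective (congrArg Subtype.val h))), fun u => ?_⟩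
  obtain ⟨k, hk⟩ := exists_triple_of_pow_three (ub₉ ⟨u, u.2.1⟩)
    ((unit_mem_muTorsion_iff ⟨u, u.2.1⟩).mp u.2)
  refine ⟨k, Subtype.ext ?_⟩
  apply homOf_injective G₉
  change homOf G₉ _ (autEquiv G₉ (SemidirectProduct.inl (triple k))) = homOf G₉ _ (u : Aut toy₉.BN)
  rw [homOf_autEquiv, hk]
  exact (homOf_unit_toy₉ ⟨u, u.2.1⟩).symm

/-- **`m := μ_3(B_N) ⥲ μ₃`** for toy no. 9 (`inl(3k) ↦ k`). [cite: MochizukiEtTh2009, Lem 5.9 (iv) p.332 (PDF p.106)] -/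
noncomputable def muEquiv₉ : toy₉.muTorsion toy₉.BN toy₉.N ≃* Multiplicative (ZMod 3) :=
  (MulEquiv.ofBijective muHom₉ muHom₉_bijective).symm

/-- `m(inl(3k)) = k` (the identification of cyclotomes on elements). [cite: MochizukiEtTh2009, Lem 5.9 (iv) p.332 (PDF p.106)] -/
@[simp] theorem muEquiv₉_muHom₉ (k : Multiplicative (ZMod 3)) : muEquiv₉ (muHom₉ k) = k :=
  (MulEquiv.ofBijective muHom₉ muHom₉_bijective).symm_apply_apply k

end Toy

end ThetaFrobenioid

end Literature.AnabelianGeometry.EtaleTheta
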